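import Literature.AlgebraicGeometry.Resolution.KollarStep3Centres
import Literature.AlgebraicGeometry.Resolution.BlowupSequencesPruneMarked
import HarnessLib

/-!
# Step 3 of the proof of Theorem 3.107: the refined boundary under flat pull-backs of triples (Kollár 2007, 3.111 Step 3 with 3.34)

Topic: `Literature/AlgebraicGeometry/Resolution`. A brick of the decomposition of the named fact
`Kollar2007Thm3_107` (`KollarBlowupSequenceFunctors.lean`; J. Kollár, *Lectures on Resolution of
Singularities*, Ann. of Math. Stud. 166 (2007), 3.111 Step 3 with 3.34.1–3.34.2, pp. 131 and
177–178 of the held copy: "The functoriality conditions are just as obvious as before").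

The functor of Step 3 chooses its centre from the refined boundary `E^{(i,a)}` and the labels
`(i, a)` (`KollarStep3Centres.lean`). For the functoriality package 3.34 one needs that these data
PULL BACK along the morphisms of 3.34.1 (smooth `h : Y → X` with `T' = (Y, h^*I, h^{-1}E)`) and of
3.34.2 (changes of fields) — both flat, with `I' = h^*I` and `E' = h^{-1}E` position by position.
PROVED here, for such a flat pull-back of triples:

* `divExp_pieceBelow_eq_of_flat` — the multiplicity of `h^*I` along a piece `Q` of `h^{-1}E^i` is the
  multiplicity of `I` along the piece of `E^i` below `Q` (the exponent comparison inside
  `mPart_eq_comap_of_flat`, `KollarNmPartPullback.lean`);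
* **`refDiv_eq_comap_of_flat`** — `E'^{(i,a)} = h^*E^{(i,a)}` for all `(i, a)` (positions are kept:
  `E'` is the list `h^{-1}E`); `sigCentre_eq_comap_of_flat` — strata pull back to strata;
* `labels_subset_of_flat`, `labels_eq_of_flat_of_surjective` — labels can only disappear (when
  `h^{-1}E^{(i,a)} = ∅`), and are kept by surjective `h`; `hasCommonPoint_sigSet_of_flat`,
  `hasCommonPoint_sigSet_iff_of_surjective`, `hasCommonPoint_sigSet_of_comap_ne_top` — common points
  of the refined divisors of a set of labels map down, lift along surjections, and exist as soon as
  the pulled-back stratum is non-empty.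

## Sources

* J. Kollár, *Lectures on Resolution of Singularities* (2007), 3.34.1–3.34.2 (p. 131), 3.111 Step 3
  (pp. 177–178 of the held copy). [Kollar2007]
-/

noncomputable section

open CategoryTheory AlgebraicGeometry TopologicalSpace

namespace Literature.AlgebraicGeometry.Resolution

universe u

namespace Kollar2007.Triple

variable {k k' : Type u} [Field k] [Field k'] {n n' : ℕ} {T : Triple k n} {T' : Triple k' n'}
  {h : T'.X ⟶ T.X} (hE : T'.boundary = T.boundary.map fun D => D.comap h) (hI : T'.ideal = T.ideal.comap h)

/-! ## Members, pieces and multiplicities under a flat pull-back -/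

include hE in
/-- The lists `E'` and `E` have the same length. [folklore] -/
theorem length_boundary_eq_of_boundary_eq : T'.boundary.length = T.boundary.length := by
  rw [hE, List.length_map]

include hE in
/-- **`E'^i = h^*E^i`**, position by position. [cite: Kollar2007, 3.34.1 (p. 131)] -/
theorem member_eq_comap (i : ℕ) : T'.member i = (T.member i).comap h := by
  by_cases hi : i < T.boundary.length
  · have hi' : i < T'.boundary.length := by rw [length_boundary_eq_of_boundary_eq hE]; exact hi
    rw [T'.member_of_lt hi', T.member_of_lt hi]
    simp only [hE, List.getElem_map]
  · have hi' : ¬ i < T'.boundary.length := by rw [length_boundary_eq_of_boundary_eq hE]; exact hi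
    rw [T'.member_of_not_lt hi', T.member_of_not_lt hi, Scheme.IdealSheafData.comap_top]

include hE hI in
/-- **The multiplicity of `h^*I` along a piece `Q` of the split boundary of `T'` is the multiplicity
of `I` along the piece below `Q`** (`h` flat; the exponent comparison of `mPart_eq_comap_of_flat`).
[cite: Kollar2007, Def.–Lemma 3.110 with 3.34 (pp. 131, 176)] -/
theorem divExp_pieceBelow_eq_of_flat [Flat h] {Q : T'.X.IdealSheafData} (hQ : Q ∈ T'.splitBoundary) :
    divExp T.ideal (pieceBelow h Q) = divExp T'.ideal Q :=
  haveI := T'.isLocallyNoetherian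
  divExp_eq_of_factorization T'.hasSNC_splitBoundary T'.splitBoundary_pairwise T'.stalkIdeal_ne_bot _ _
    (monomialIdeal_mul_nmPart_comap hE hI) (fun _ hQ _ => not_nmPart_comap_le hE hQ) hQ
    (T'.ne_top_of_mem_splitBoundary hQ)

include hE hI in
/-- **`E'^{(i,a)} = h^*E^{(i,a)}`**: the refined boundary pulls back position by position (the pieces
of `h^{-1}E^i` lie over the pieces of `E^i`, `monomialIdeal_pieces_comap`, with the same
multiplicities, `divExp_pieceBelow_eq_of_flat`). [cite: Kollar2007, 3.34.1 (p. 131) with 3.111 Step 3] -/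
theorem refDiv_eq_comap_of_flat [Flat h] (i a : ℕ) : T'.refDiv i a = (T.refDiv i a).comap h := by
  by_cases hi : i < T.boundary.length
  · have hK : T.member i ∈ T.boundary := T.member_mem_boundary hi
    have hK' : T'.member i ∈ T'.boundary := by
      rw [member_eq_comap hE]; exact comap_mem_boundary_of_mem hE hK
    rw [refDiv, refDiv, memberPieces, memberPieces, monomialIdeal_pieces_comap hE (T.labelExp a) hK,
      ← member_eq_comap hE]
    congr 1
    refine List.map_congr_left fun Q hQ => ?_
    have hQs : Q ∈ T'.splitBoundary := by
      obtain ⟨Z, hZ, rfl⟩ := mem_pieceIdeals_iff.mp hQ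
      exact T'.mem_splitBoundary_iff.mpr ⟨T'.member i, hK', Z, hZ, rfl⟩
    simp only [labelExp, divExp_pieceBelow_eq_of_flat hE hI hQs]
  · have hi' : ¬ i < T'.boundary.length := by rw [length_boundary_eq_of_boundary_eq hE]; exact hi
    have h1 : T'.refDiv i a = ⊤ := by
      rw [refDiv, memberPieces, T'.member_of_not_lt hi', boundaryPieces_top]
      simp [pieceIdeals, monomialIdeal_nil]
    have h2 : T.refDiv i a = ⊤ := by
      rw [refDiv, memberPieces, T.member_of_not_lt hi, boundaryPieces_top]
      simp [pieceIdeals, monomialIdeal_nil]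
    rw [h1, h2, Scheme.IdealSheafData.comap_top]

/-! ## Labels, strata and common points under a flat pull-back -/

include hE hI in
/-- A label of `T'` is a label of `T` (`h^*E^{(i,a)} ≠ ∅` forces `E^{(i,a)} ≠ ∅`). [folklore] -/
theorem labels_subset_of_flat [Flat h] : T'.labels ⊆ T.labels := by
  intro l hl
  have hl' : toLex ((ofLex l).1, (ofLex l).2) ∈ T'.labels := hl
  rw [T'.mem_labels_iff_refDiv_ne_top, refDiv_eq_comap_of_flat hE hI] at hl'
  have h2 : T.refDiv (ofLex l).1 (ofLex l).2 ≠ ⊤ := by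
    intro htop
    rw [htop, Scheme.IdealSheafData.comap_top] at hl'
    exact hl' rfl
  exact T.mem_labels_iff_refDiv_ne_top.mpr h2

include hE hI in
/-- Along a SURJECTIVE flat pull-back the labels are the same. [cite: Kollar2007, 3.34.2 (p. 131)] -/
theorem labels_eq_of_flat_of_surjective [Flat h] [Surjective h] : T'.labels = T.labels := by
  refine Finset.Subset.antisymm (labels_subset_of_flat hE hI) fun l hl => ?_
  have hl' : toLex ((ofLex l).1, (ofLex l).2) ∈ T.labels := hl
  rw [T.mem_labels_iff_refDiv_ne_top] at hl'
  show toLex ((ofLex l).1, (ofLex l).2) ∈ T'.labels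
  rw [T'.mem_labels_iff_refDiv_ne_top, refDiv_eq_comap_of_flat hE hI]
  exact fun htop => hl' ((comap_eq_top_iff_of_surjective h _).mp htop)

/-- Finite sums of ideal sheaves commute with pull-back. [folklore] -/
theorem _root_.Literature.AlgebraicGeometry.Resolution.finsetSup_comap {Y Y' : Scheme.{u}} (g : Y' ⟶ Y)
    {ι : Type*} (s : Finset ι) (F : ι → Y.IdealSheafData) :
    (s.sup F).comap g = s.sup fun i => (F i).comap g := by
  classical
  induction s using Finset.induction_on with
  | empty => simp
  | insert a s ha ih => rw [Finset.sup_insert, Finset.sup_insert, Scheme.IdealSheafData.comap_sup, ih]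

include hE hI in
/-- **Strata pull back to strata**: `sigCentre' σ = h^*(sigCentre σ)`. [cite: Kollar2007, 3.34.1 (p. 131)] -/
theorem sigCentre_eq_comap_of_flat [Flat h] [DecidableEq T.X.IdealSheafData] [DecidableEq T'.X.IdealSheafData]
    (σ : Finset (ℕ ×ₗ ℕ)) : T'.sigCentre σ = (T.sigCentre σ).comap h := by
  rw [sigCentre, sigCentre, sigSet, sigSet, Finset.sup_image, Finset.sup_image, finsetSup_comap]
  congr 1
  funext l
  simp only [Function.comp_apply, id]
  exact refDiv_eq_comap_of_flat hE hI _ _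

include hE hI in
/-- The support of a pulled-back stratum. [folklore] -/
theorem mem_support_sigCentre_iff_of_flat [Flat h] [DecidableEq T.X.IdealSheafData] [DecidableEq T'.X.IdealSheafData]
    (σ : Finset (ℕ ×ₗ ℕ)) (x' : T'.X) : x' ∈ (T'.sigCentre σ).support ↔ h x' ∈ (T.sigCentre σ).support := by
  rw [sigCentre_eq_comap_of_flat hE hI, Scheme.IdealSheafData.support_comap]
  rfl

include hE hI in
/-- **Common points map down**: if the refined divisors of `σ` on `T'` have a common point, so do
those on `T`. [folklore] -/
theorem hasCommonPoint_sigSet_of_flat [Flat h] [DecidableEq T.X.IdealSheafData] [DecidableEq T'.X.IdealSheafData]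
    {σ : Finset (ℕ ×ₗ ℕ)} (hσ : HasCommonPoint (T'.sigSet σ)) : HasCommonPoint (T.sigSet σ) := by
  rw [T'.hasCommonPoint_sigSet_iff] at hσ
  rw [T.hasCommonPoint_sigSet_iff]
  obtain ⟨x', hx'⟩ := hσ
  exact ⟨h x', (mem_support_sigCentre_iff_of_flat hE hI σ x').mp hx'⟩

include hE hI in
/-- **A non-empty pulled-back stratum has a common point upstairs.** [folklore] -/
theorem hasCommonPoint_sigSet_of_comap_ne_top [Flat h] [DecidableEq T.X.IdealSheafData] [DecidableEq T'.X.IdealSheafData]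
    {σ : Finset (ℕ ×ₗ ℕ)} (hne : (T.sigCentre σ).comap h ≠ ⊤) : HasCommonPoint (T'.sigSet σ) := by
  rw [T'.hasCommonPoint_sigSet_iff, sigCentre_eq_comap_of_flat hE hI]
  rw [Ne, ← Scheme.IdealSheafData.support_eq_bot_iff] at hne
  rw [Set.nonempty_iff_ne_empty]
  intro he
  exact hne (TopologicalSpace.Closeds.ext he)

include hE hI in
/-- Along a surjective flat pull-back, common points correspond. [cite: Kollar2007, 3.34.2 (p. 131)] -/
theorem hasCommonPoint_sigSet_iff_of_surjective [Flat h] [Surjective h] [DecidableEq T.X.IdealSheafData]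
    [DecidableEq T'.X.IdealSheafData] (σ : Finset (ℕ ×ₗ ℕ)) :
    HasCommonPoint (T'.sigSet σ) ↔ HasCommonPoint (T.sigSet σ) := by
  refine ⟨hasCommonPoint_sigSet_of_flat hE hI, fun hσ => ?_⟩
  rw [T.hasCommonPoint_sigSet_iff] at hσ
  rw [T'.hasCommonPoint_sigSet_iff]
  obtain ⟨x, hx⟩ := hσ
  obtain ⟨x', rfl⟩ := h.surjective x
  exact ⟨x', (mem_support_sigCentre_iff_of_flat hE hI σ x').mpr hx⟩

/-- The labels of a set with a non-empty pulled-back stratum are labels of `T'`. [folklore] -/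
theorem subset_labels_of_hasCommonPoint [DecidableEq T'.X.IdealSheafData] {σ : Finset (ℕ ×ₗ ℕ)}
    (hσ : HasCommonPoint (T'.sigSet σ)) : σ ⊆ T'.labels := by
  obtain ⟨x', hx'⟩ := hσ
  intro l hl
  have hx : x' ∈ (T'.refDiv (ofLex l).1 (ofLex l).2).support := hx' _ (Finset.mem_image.mpr ⟨l, hl, rfl⟩)
  show toLex ((ofLex l).1, (ofLex l).2) ∈ T'.labels
  rw [T'.mem_labels_iff_refDiv_ne_top]
  intro htop
  rw [htop, Scheme.IdealSheafData.support_top] at hx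
  exact not_mem_bot_closeds x' hx

/-! ## The two situations of 3.34 -/

/-- For the smooth pull-backs of 3.34.1 (`Triple.IsPullbackAlong`): `E'^{(i,a)} = h^*E^{(i,a)}`.
[cite: Kollar2007, 3.34.1 (p. 131)] -/
theorem IsPullbackAlong.refDiv_eq {k : Type u} [Field k] {n n' : ℕ} {T : Triple k n} {T' : Triple k n'}
    {h : T'.X ⟶ T.X} [Flat h] (hT : T.IsPullbackAlong T' h) (i a : ℕ) :
    T'.refDiv i a = (T.refDiv i a).comap h :=
  refDiv_eq_comap_of_flat hT.boundary_eq hT.ideal_eq i a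

/-- For the changes of fields of 3.34.2 (`Triple.IsFieldChange`): `E'^{(i,a)} = g^*E^{(i,a)}`.
[cite: Kollar2007, 3.34.2 (p. 131)] -/
theorem IsFieldChange.refDiv_eq {K L : Type u} [Field K] [Field L] {σ : K →+* L} {n n' : ℕ}
    {T : Triple K n} {T' : Triple L n'} {g : T'.X ⟶ T.X} (hF : IsFieldChange σ T T' g) (i a : ℕ) :
    T'.refDiv i a = (T.refDiv i a).comap g :=
  haveI : Flat g := MorphismProperty.of_isPullback (P := @Flat) hF.isPullback.flip inferInstance
  refDiv_eq_comap_of_flat hF.boundary_eq hF.ideal_eq i a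

end Kollar2007.Triple

end Literature.AlgebraicGeometry.Resolution

end
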